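import Summits.BirchSwinnertonDyer.BirchSwinnertonDyer.Theorems.CountingDoorF2AtThreeSchneiderOnDoorSubfamilyDivisionValues
import Literature.NumberTheory.EllipticCurves.CanonicalPAdicHeightFormalGroupValueProofs
import HarnessLib

/-!
# BirchSwinnertonDyer / CountingDoorF2AtThree — crux I4loc `SchneiderOnDoorSubfamily`
# (stmt-BirchSwinnertonDyer-19682), line `valuation-class-at-three` (v3): the CROSS TERM
# `⟨2P₁ + 3P₂, 2P₁ + 3P₂⟩ ∈ 3ℤ₃` for every type-∅ member of the door class

Helper file (`--supports stmt-BirchSwinnertonDyer-19682 --as helper`; cell bsd-rank2, seat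
cd-valclass-denom; PARTITION: none — r_an ≥ 2, summit axis S0). The v3 skeleton
(`Cruxes/SchneiderOnDoorSubfamily/Lines/valuation_class_at_three.lean`, seat cd-valclass-digits) asks, in
its load-bearing `stub_heightDigits`, for every member `a` of the chosen subfamily and every canonical
`3`-adic height datum `Dh` on `a.curve`, besides the two first digits, the bound

  `‖Dh.pairing (2 • P₁ + 3 • P₂) (2 • P₁ + 3 • P₂)‖ ≤ 3⁻¹`.

This file proves that third conjunct for EVERY type-∅ member of the door class `a ≡ (1, 0, 1, 0) (mod 3)`
(in particular for the certificate class `(7, 0, 4, 0) mod 9`): `3 ∣ ψ₂(P₁)` and `3 ∣ ψ₃(P₂)`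
(`params_three_dvd_ψ_two_markedPoint₁`, `params_three_dvd_ψ_three_markedPoint₂`) put `2P₁` and `3P₂`, hence
their sum, in `E(ℚ) ∩ E₁(ℚ₃)` (`WeierstrassCurve.kernelOfReductionAt`, a subgroup), where the canonical height
is `3ℤ₃`-valued on a type-∅ model (`norm_pairing_self_le_inv_of_mem_kernelOfReductionAt`, Mazur–Tate 1983
§3.3 integrality for an integral equation all of whose rational points reduce non-singularly).

B1 honesty: local algebra and the definition of the canonical height; nothing here mentions a Selmer group,
an `L`-value or an analytic rank.

References: Mazur–Tate 1983 §3.3 [MazurTate1983Biext]; Mazur–Stein–Tate 2006 §1 [MazurSteinTate2006];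
Silverman *AEC* VII.2, Ex. 3.7 [SilvermanAEC2009].
-/

-- the summit namespace `Summit.BirchSwinnertonDyer.BirchSwinnertonDyer.Theorems` repeats a component by design
-- (single-conjunct summit, CONVENTIONS §1), which the `dupNamespace` linter would flag on every declaration.
set_option linter.dupNamespace false

noncomputable section

open scoped Classical
open WeierstrassCurve Literature.NumberTheory.EllipticCurves
  Literature.NumberTheory.EllipticCurves.BhargavaHo2022

namespace Summit.BirchSwinnertonDyer.BirchSwinnertonDyer.Theorems

variable (a : Params)

/-- `a.curve` is a `ℤ`-integral equation (it IS the base change of `a.curveInt`); a `Prop`-valued class, so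
this term can be supplied wherever the instance is wanted. [cite: BhargavaHo2022, §1 (definition of F₂)] -/
theorem params_isIntegral_curve : a.curve.IsIntegral ℤ := ⟨a.curveInt, rfl⟩

/-- **The canonical height is `pℤ_p`-valued on `E_a(ℚ) ∩ E₁(ℚ_p)` for a type-∅ member** (`p ≥ 3`, `Dh`
canonical): `‖Dh.pairing Q Q‖ ≤ p⁻¹` for every rational point `Q` reducing to `O` modulo `p`.
[cite: MazurTate1983Biext, §3.3 (display after (3.3.4)) and (4.4) Prop.] -/
theorem params_norm_pairing_self_le_inv_of_mem_kernel (p : ℕ) [Fact p.Prime] (hp3 : 3 ≤ p)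
    (hΔ : ∀ ℓ : ℕ, ℓ.Prime → ¬ (ℓ : ℤ) ^ 2 ∣ a.curveInt.Δ) {Dh : PAdicHeightData a.curve p}
    (hDh : Dh.IsCanonical) (Q : a.curve.toAffine.Point)
    (hQ : haveI := params_isIntegral_curve a; Q ∈ a.curve.kernelOfReductionAt p) :
    ‖Dh.pairing Q Q‖ ≤ (p : ℝ)⁻¹ :=
  a.curveInt.norm_pairing_self_le_inv_of_mem_kernelOfReductionAt p hp3 hΔ hDh Q hQ

variable {a}

/-- **`n • P₁ ∈ E₁(ℚ_p)` as soon as `p ∣ ψₙ(P₁)`** (type ∅ at `p`, i.e. `p² ∤ Δ(a)`; `n • P₁ = O` is allowed).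
[cite: SilvermanAEC2009, Exercise 3.7(d)] -/
theorem params_zsmul_markedPoint₁_mem_kernel (p : ℕ) [Fact p.Prime] (hΔ : ¬ (p : ℤ) ^ 2 ∣ a.curveInt.Δ)
    (h : a.IsMember) {n : ℤ} (hp : (p : ℤ) ∣ (a.curveInt.ψ n).evalEval a.a₂ 0) :
    haveI := params_isIntegral_curve a
    n • a.markedPoint₁ h ∈ a.curve.kernelOfReductionAt p := by
  obtain ⟨h', e'⟩ := params_markedPoint₁_eq_some_intCast h
  rw [e']
  exact a.curveInt.zsmul_some_mem_kernelOfReductionAt_of_dvd_ψ p h'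
    (a.curveInt.hasNonsingularReductionAt_of_not_sq_dvd_Δ p hΔ h') hp

/-- **`n • P₂ ∈ E₁(ℚ_p)` as soon as `p ∣ ψₙ(P₂)`.** [cite: SilvermanAEC2009, Exercise 3.7(d)] -/
theorem params_zsmul_markedPoint₂_mem_kernel (p : ℕ) [Fact p.Prime] (hΔ : ¬ (p : ℤ) ^ 2 ∣ a.curveInt.Δ)
    (h : a.IsMember) {n : ℤ} (hp : (p : ℤ) ∣ (a.curveInt.ψ n).evalEval a.a₂' 0) :
    haveI := params_isIntegral_curve a
    n • a.markedPoint₂ h ∈ a.curve.kernelOfReductionAt p := by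
  obtain ⟨h', e'⟩ := params_markedPoint₂_eq_some_intCast h
  rw [e']
  exact a.curveInt.zsmul_some_mem_kernelOfReductionAt_of_dvd_ψ p h'
    (a.curveInt.hasNonsingularReductionAt_of_not_sq_dvd_Δ p hΔ h') hp

/-- **On the door class `a ≡ (1, 0, 1, 0) (mod 3)`, `2 • P₁ + 3 • P₂ ∈ E₁(ℚ₃)`** (`P̃₁` has order `2`, `P̃₂`
order `3` on `y² + xy = x³ − x` over `𝔽₃`; type ∅ at `3`). [cite: SilvermanAEC2009, VII.2.2] -/
theorem params_crossTerm_mem_kernel (hΔ : ¬ (3 : ℤ) ^ 2 ∣ a.curveInt.Δ) (h : a.IsMember)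
    (h₁ : (a.a₁ : ZMod 3) = 1) (h₂ : (a.a₂ : ZMod 3) = 0) (h₂' : (a.a₂' : ZMod 3) = 1)
    (h₃ : (a.a₃ : ZMod 3) = 0) :
    haveI := params_isIntegral_curve a
    2 • a.markedPoint₁ h + 3 • a.markedPoint₂ h ∈ a.curve.kernelOfReductionAt 3 := by
  haveI := params_isIntegral_curve a
  have hd₂ : (3 : ℤ) ∣ a.a₂ := by exact_mod_cast (ZMod.intCast_zmod_eq_zero_iff_dvd a.a₂ 3).mp h₂
  have hd₃ : (3 : ℤ) ∣ a.a₃ := by exact_mod_cast (ZMod.intCast_zmod_eq_zero_iff_dvd a.a₃ 3).mp h₃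
  have m₁ := params_zsmul_markedPoint₁_mem_kernel 3 (by exact_mod_cast hΔ) h (n := 2)
    (by exact_mod_cast params_three_dvd_ψ_two_markedPoint₁ a hd₂ hd₃)
  have m₂ := params_zsmul_markedPoint₂_mem_kernel 3 (by exact_mod_cast hΔ) h (n := 3)
    (by exact_mod_cast params_three_dvd_ψ_three_markedPoint₂ a h₁ h₂ h₂' h₃)
  rw [params_nsmul_eq_zsmul, params_nsmul_eq_zsmul]
  exact AddSubgroup.add_mem _ (by exact_mod_cast m₁) (by exact_mod_cast m₂)

/-- **THE CROSS TERM of `stub_heightDigits` (v3), for every member.** For a type-∅ member `a` of `F₂` on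
the door class `a ≡ (1, 0, 1, 0) (mod 3)` (in particular on the certificate class `(7, 0, 4, 0) mod 9`) and
every CANONICAL `3`-adic height datum `Dh` on `a.curve`:
`‖Dh.pairing (2 • P₁ + 3 • P₂) (2 • P₁ + 3 • P₂)‖ ≤ 3⁻¹`.
[cite: MazurTate1983Biext, §3.3 (display after (3.3.4)) and (4.4) Prop.] -/
theorem params_norm_pairing_crossTerm_le (hΔ : ∀ ℓ : ℕ, ℓ.Prime → ¬ (ℓ : ℤ) ^ 2 ∣ a.curveInt.Δ)
    (h : a.IsMember) (h₁ : (a.a₁ : ZMod 3) = 1) (h₂ : (a.a₂ : ZMod 3) = 0) (h₂' : (a.a₂' : ZMod 3) = 1)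
    (h₃ : (a.a₃ : ZMod 3) = 0) {Dh : PAdicHeightData a.curve 3} (hDh : Dh.IsCanonical) :
    ‖Dh.pairing (2 • a.markedPoint₁ h + 3 • a.markedPoint₂ h)
        (2 • a.markedPoint₁ h + 3 • a.markedPoint₂ h)‖ ≤ (3 : ℝ)⁻¹ := by
  have := params_norm_pairing_self_le_inv_of_mem_kernel a 3 le_rfl hΔ hDh _
    (params_crossTerm_mem_kernel (hΔ 3 (by norm_num)) h h₁ h₂ h₂' h₃)
  exact_mod_cast this

end Summit.BirchSwinnertonDyer.BirchSwinnertonDyer.Theorems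

end
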